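import Summits.NavierStokesRegularity.TurbBounds.LegendreCoeffs
import HarnessLib

/-!
# The fw16 cross term `X(W) = ∫ φ′·Im(W′W̄)` for polynomial amplitudes: exact tracked part on FW16's index set `S` + tail product,
# and the Young bound on the tail (rbsdp SPEC 2.5 / FW16 (B5), SPEC 2.7)
(cell `pub-turb` / `turb-bounds`, shear lane; v2 staging = item V2-BRIDGE ('BRIDGE-1' of FW16-CHAIN-DESIGN.md), written by pub-turb-shear gen 7,
2026-08-22. TREE-ONLY dependencies: `LegendreCoeffs` (Legendre expansion / finite Parseval) and the Literature Legendre files it imports.)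

HONEST FRAMING: rigorous bounds for the stated PDE and boundary conditions; no claim about physical turbulence beyond the bound.
PROVED, for a profile derivative `g` = polynomial of degree `≤ P`, truncation order `N`, and real polynomials `F` ("`U`", Legendre coefficients
`f`) and `G` ("`V′`", coefficients `e`):
* `lam3 g n m = ∫_{−1}^{1} g·P_n·P_m` and its selection rules `lam3_eq_zero_of_far/_far'` (`|n − m| > P ⇒ 0`, orthogonality);
* `tailFrom t F = F − Σ_{k<t} ĉ_k(F) P_k` (the Legendre tail from index `t`), its coefficients, degree and Parseval window
  (`integral_tailFrom_sq`: `‖tailFrom t F‖² = Σ_{k<L} w_{t+k} ĉ_{t+k}(F)²`);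
* `integral_g_mul_mul` (full bilinear expansion `∫ g·G·F = Σ_n Σ_m f_n e_m Λ_g(n,m)`);
* **`coupling_split`** (SPEC 2.5 = FW16 (B5)): `∫ g·G·F = xFin N P g f e + ∫ g·(tailFrom (N+2) G)·(tailFrom (N+1) F)` where
  `xFin = Σ_{n<N+P+2} Σ_{m<N+P+3} [S(n,m)]·Λ_g(n,m)·f_n·e_m` with FW16's index set `S = {(m ≤ N+1 ∧ n ≤ N+P+1) ∨ (N+2 ≤ m ≤ N+P ∧ n ≤ N)}`
  (= the support pattern of `ShearSpecPieces.kTab N P p`, entry `Λ(m,n,p)`; here `Λ_g(n,m) = Σ_p ĝ_p ∫P_p P_n P_m` stays an integral, so nothing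
  about triple products is needed) — 'the omitted pairs are EXACTLY `∫ g·w̃₁·w̃₀`';
* **`coupling_split_pair`**: for the pair `(U, V)`: `∫ g·(V′U − U′V) = (xFin g ĉ(U) ĉ(V′) − xFin g ĉ(V) ĉ(U′)) + X_t`,
  `X_t = ∫ g·(ṽ₁ũ₀ − ũ₁ṽ₀)` (`ũ₀ = tailFrom (N+1) U`, `ũ₁ = tailFrom (N+2) U′`, …);
* **`coupling_tail_young`** (SPEC 2.7): `|g| ≤ T` on `[−1,1]`, `δ > 0` ⇒ `|X_t| ≤ T·((δ/2)(‖ũ₀‖² + ‖ṽ₀‖²) + (‖ũ₁‖² + ‖ṽ₁‖²)/(2δ))` — the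
  hypothesis `hX` of the staged `ShearModeAssembly.mode_assembly` once the norms are written as coefficient windows (`integral_tailFrom_sq`).
-/

set_option linter.style.longLine false

noncomputable section

namespace Summit.NavierStokesRegularity.TurbBounds.ShearCoupling

open Polynomial intervalIntegral MeasureTheory Set Finset Literature.Analysis.SpecialFunctions
open Summit.NavierStokesRegularity.TurbBounds.LadderTail (w w_pos)
open Summit.NavierStokesRegularity.TurbBounds.LegendreCoeffs

/-! ## 1. The profile-weighted Gram numbers `Λ_g(n, m) = ∫ g P_n P_m` and their selection rules -/

/-- `Λ_g(n, m) := ∫_{−1}^{1} g·P_n·P_m` for a polynomial profile derivative `g`. -/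
def lam3 (gp : ℝ[X]) (n m : ℕ) : ℝ :=
  ∫ x in (-1 : ℝ)..1, gp.eval x * (legendre n).eval x * (legendre m).eval x

/-- `Λ_g` is symmetric. -/
theorem lam3_comm (gp : ℝ[X]) (n m : ℕ) : lam3 gp n m = lam3 gp m n := by
  unfold lam3
  exact intervalIntegral.integral_congr fun x _ => by ring

/-- Selection rule: `Λ_g(n, m) = 0` when `deg g ≤ P` and `n + P < m` (`g·P_n` has degree `< m`, orthogonality). -/
theorem lam3_eq_zero_of_far {gp : ℝ[X]} {P n m : ℕ} (hg : gp.natDegree ≤ P) (h : n + P < m) : lam3 gp n m = 0 := by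
  unfold lam3
  have hdeg : (gp * legendre n).degree < m := by
    refine (degree_le_natDegree).trans_lt ?_
    have h1 : (gp * legendre n).natDegree ≤ P + n :=
      (natDegree_mul_le).trans (add_le_add hg (natDegree_legendre n).le)
    exact_mod_cast lt_of_le_of_lt h1 (by omega)
  have h0 := integral_legendre_mul_eq_zero hdeg
  have e : ∫ x in (-1 : ℝ)..1, gp.eval x * (legendre n).eval x * (legendre m).eval x
      = ∫ x in (-1 : ℝ)..1, (legendre m).eval x * (gp * legendre n).eval x :=
    intervalIntegral.integral_congr fun x _ => by rw [eval_mul]; ring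
  rw [e, h0]

/-- Selection rule, mirrored: `Λ_g(n, m) = 0` when `deg g ≤ P` and `m + P < n`. -/
theorem lam3_eq_zero_of_far' {gp : ℝ[X]} {P n m : ℕ} (hg : gp.natDegree ≤ P) (h : m + P < n) : lam3 gp n m = 0 := by
  rw [lam3_comm]; exact lam3_eq_zero_of_far hg h

/-- `Λ_g` for an explicit Legendre combination `g = Σ_{p ≤ P} ĝ_p P_p`: `Λ_g(n, m) = Σ_p ĝ_p ∫ P_p P_n P_m` (linearity). -/
theorem lam3_expansion (P : ℕ) (ghat : ℕ → ℝ) (n m : ℕ) :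
    lam3 (∑ p ∈ range (P + 1), C (ghat p) * legendre p) n m
      = ∑ p ∈ range (P + 1), ghat p * ∫ x in (-1 : ℝ)..1, (legendre p).eval x * (legendre n).eval x * (legendre m).eval x := by
  unfold lam3
  have hexp : ∀ x, (∑ p ∈ range (P + 1), C (ghat p) * legendre p).eval x * (legendre n).eval x * (legendre m).eval x
      = ∑ p ∈ range (P + 1), ghat p * ((legendre p).eval x * (legendre n).eval x * (legendre m).eval x) := by
    intro x
    rw [eval_finsetSum, sum_mul, sum_mul]
    refine sum_congr rfl fun p _ => ?_
    rw [eval_mul, eval_C]; ring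
  simp_rw [hexp]
  rw [intervalIntegral.integral_finsetSum (fun p _ => Continuous.intervalIntegrable (by fun_prop) _ _)]
  exact sum_congr rfl fun p _ => by rw [intervalIntegral.integral_const_mul]

/-! ## 2. Legendre tails from an index -/

/-- The Legendre tail of `F` from index `t`: `F − Σ_{k<t} ĉ_k(F)·P_k = Σ_{k ≥ t} ĉ_k(F)·P_k`. -/
def tailFrom (t : ℕ) (F : ℝ[X]) : ℝ[X] := F - ∑ k ∈ range t, C (legCoeff F k) * legendre k

/-- Coefficients of the tail: `0` below `t`, those of `F` from `t` on. -/
theorem legCoeff_tailFrom (t : ℕ) (F : ℝ[X]) (k : ℕ) : legCoeff (tailFrom t F) k = if k < t then 0 else legCoeff F k := by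
  unfold tailFrom
  rw [legCoeff_sub]
  rcases Nat.eq_zero_or_pos t with rfl | ht
  · have h0 : legCoeff (0 : ℝ[X]) k = 0 := by unfold legCoeff; simp
    simp [h0]
  · obtain ⟨s, rfl⟩ : ∃ s, t = s + 1 := ⟨t - 1, by omega⟩
    rw [legCoeff_expansion]
    by_cases hk : k < s + 1
    · rw [if_pos hk, if_pos (by omega)]; ring
    · rw [if_neg hk, if_neg (by omega)]; ring

/-- Degree of the tail: `≤ max (deg F) (t − 1)`. -/
theorem natDegree_tailFrom_le (t : ℕ) (F : ℝ[X]) : (tailFrom t F).natDegree ≤ max F.natDegree (t - 1) := by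
  unfold tailFrom
  refine (natDegree_sub_le _ _).trans (max_le_max le_rfl ?_)
  refine natDegree_sum_le_of_forall_le _ _ fun k hk => ?_
  have hk' : k ≤ t - 1 := by have := mem_range.mp hk; omega
  exact (natDegree_C_mul_le _ _).trans ((natDegree_legendre k).le.trans hk')

/-- **Parseval window for a tail**: `∫ (tailFrom t F)² = Σ_{k<L} w_{t+k}·ĉ_{t+k}(F)²` whenever `deg F < t + L`. -/
theorem integral_tailFrom_sq (t : ℕ) (F : ℝ[X]) {L : ℕ} (hL : F.natDegree < t + L) :
    ∫ x in (-1 : ℝ)..1, (tailFrom t F).eval x ^ 2 = ∑ k ∈ range L, w (t + k) * legCoeff F (t + k) ^ 2 := by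
  have hdeg : (tailFrom t F).natDegree < t + L :=
    lt_of_le_of_lt (natDegree_tailFrom_le t F) (max_lt hL (by omega))
  rw [integral_sq_eq_sum_of_lt _ hdeg, sum_range_add]
  have hz : ∑ k ∈ range t, w k * legCoeff (tailFrom t F) k ^ 2 = 0 :=
    sum_eq_zero fun k hk => by rw [legCoeff_tailFrom, if_pos (mem_range.mp hk)]; ring
  rw [hz, zero_add]
  exact sum_congr rfl fun k _ => by rw [legCoeff_tailFrom, if_neg (by omega)]

/-- `F = (head below t) + tailFrom t F`, pointwise. -/
theorem eval_head_add_tailFrom (t : ℕ) (F : ℝ[X]) (x : ℝ) :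
    F.eval x = (∑ k ∈ range t, C (legCoeff F k) * legendre k).eval x + (tailFrom t F).eval x := by
  unfold tailFrom; rw [eval_sub]; ring

/-! ## 3. Full bilinear expansion of `∫ g·G·F` -/

/-- `∫ g·G·F = Σ_{m<R} Σ_{n<R} ĉ_n(F)·ĉ_m(G)·Λ_g(n, m)` (outer sum over the coefficients of `G`) for any window `R` beyond the degrees. -/
theorem integral_g_mul_mul' (gp F G : ℝ[X]) {R : ℕ} (hF : F.natDegree < R) (hG : G.natDegree < R) :
    ∫ x in (-1 : ℝ)..1, gp.eval x * (G.eval x * F.eval x)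
      = ∑ m ∈ range R, ∑ n ∈ range R, legCoeff F n * legCoeff G m * lam3 gp n m := by
  obtain ⟨R', rfl⟩ : ∃ R', R = R' + 1 := ⟨R - 1, by omega⟩
  have hexp : ∀ x, gp.eval x * (G.eval x * F.eval x)
      = ∑ m ∈ range (R' + 1), ∑ n ∈ range (R' + 1),
          legCoeff F n * legCoeff G m * (gp.eval x * (legendre n).eval x * (legendre m).eval x) := by
    intro x
    conv_lhs => rw [eq_sum_legCoeff F (N := R') (by omega), eq_sum_legCoeff G (N := R') (by omega)]
    rw [eval_finsetSum, eval_finsetSum, sum_mul, mul_sum]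
    refine sum_congr rfl fun m _ => ?_
    rw [mul_sum, mul_sum]
    refine sum_congr rfl fun n _ => ?_
    rw [eval_mul, eval_C, eval_mul, eval_C]; ring
  simp_rw [hexp]
  rw [intervalIntegral.integral_finsetSum (fun m _ => ?_)]
  · refine sum_congr rfl fun m _ => ?_
    rw [intervalIntegral.integral_finsetSum (fun n _ => Continuous.intervalIntegrable (by fun_prop) _ _)]
    refine sum_congr rfl fun n _ => ?_
    rw [intervalIntegral.integral_const_mul]
    rfl
  · exact (continuous_finsetSum _ fun n _ => by fun_prop).intervalIntegrable _ _

/-- `∫ g·G·F = Σ_{n<R} Σ_{m<R} ĉ_n(F)·ĉ_m(G)·Λ_g(n, m)` for any window `R` beyond the degrees of `F` and `G`. -/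
theorem integral_g_mul_mul (gp F G : ℝ[X]) {R : ℕ} (hF : F.natDegree < R) (hG : G.natDegree < R) :
    ∫ x in (-1 : ℝ)..1, gp.eval x * (G.eval x * F.eval x)
      = ∑ n ∈ range R, ∑ m ∈ range R, legCoeff F n * legCoeff G m * lam3 gp n m := by
  rw [integral_g_mul_mul' gp F G hF hG, sum_comm]

/-! ## 4. FW16's index set `S` and the split -/

/-- FW16 (B5) / rbsdp SPEC 2.5 index set `S` of tracked coefficient pairs (`n` indexes `ĉ(W)`, `m` indexes `ĉ(W′)`):
`(m ≤ N+1 ∧ n ≤ N+P+1) ∨ (N+2 ≤ m ≤ N+P ∧ n ≤ N)` — literally the support condition of `ShearSpecPieces.kTab N P p`. -/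
def inS (N P n m : ℕ) : Prop := (m ≤ N + 1 ∧ n ≤ N + P + 1) ∨ (N + 2 ≤ m ∧ m ≤ N + P ∧ n ≤ N)

/-- Membership in `S` is decidable (it is a Boolean combination of `ℕ`-inequalities). -/
instance instDecidableInS (N P n m : ℕ) : Decidable (inS N P n m) := by unfold inS; infer_instance

/-- **The exact tracked part** of `∫ g·G·F`: `Σ_{n<N+P+2} Σ_{m<N+P+3} [S(n,m)]·Λ_g(n,m)·f_n·e_m`. -/
def xFin (N P : ℕ) (gp : ℝ[X]) (f e : ℕ → ℝ) : ℝ :=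
  ∑ n ∈ range (N + P + 2), ∑ m ∈ range (N + P + 3), (if inS N P n m then lam3 gp n m else 0) * f n * e m

/-- `xFin` depends on `f, e` only through the window. -/
theorem xFin_congr {N P : ℕ} {gp : ℝ[X]} {f f' e e' : ℕ → ℝ} (hf : ∀ n < N + P + 2, f n = f' n) (he : ∀ m < N + P + 3, e m = e' m) :
    xFin N P gp f e = xFin N P gp f' e' := by
  unfold xFin
  exact sum_congr rfl fun n hn => sum_congr rfl fun m hm => by rw [hf n (mem_range.mp hn), he m (mem_range.mp hm)]

/-- Rectangular window reduction of a double sum whose summand vanishes outside `[0, M₁) × [0, M₂)`. -/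
theorem sum_sum_window {Φ : ℕ → ℕ → ℝ} {M₁ M₂ R : ℕ} (h1 : M₁ ≤ R) (h2 : M₂ ≤ R)
    (hz1 : ∀ n m, M₁ ≤ n → Φ n m = 0) (hz2 : ∀ n m, M₂ ≤ m → Φ n m = 0) :
    ∑ n ∈ range R, ∑ m ∈ range R, Φ n m = ∑ n ∈ range M₁, ∑ m ∈ range M₂, Φ n m := by
  obtain ⟨D₁, rfl⟩ := Nat.exists_eq_add_of_le h1
  have inner : ∀ n, ∑ m ∈ range (M₁ + D₁), Φ n m = ∑ m ∈ range M₂, Φ n m := by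
    intro n
    obtain ⟨D₂, hD₂⟩ := Nat.exists_eq_add_of_le h2
    rw [hD₂, sum_range_add]
    have hz : ∑ k ∈ range D₂, Φ n (M₂ + k) = 0 := sum_eq_zero fun k _ => hz2 _ _ (by omega)
    rw [hz, add_zero]
  rw [sum_range_add]
  have hz : ∑ k ∈ range D₁, ∑ m ∈ range (M₁ + D₁), Φ (M₁ + k) m = 0 :=
    sum_eq_zero fun k _ => sum_eq_zero fun m _ => hz1 _ _ (by omega)
  rw [hz, add_zero]
  exact sum_congr rfl fun n _ => inner n

/-- **Coupling split** (rbsdp SPEC 2.5 = FW16 (B5)), for `deg g ≤ P`: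
`∫ g·G·F = xFin N P g ĉ(F) ĉ(G) + ∫ g·(tailFrom (N+2) G)·(tailFrom (N+1) F)`. -/
theorem coupling_split (N P : ℕ) (gp F G : ℝ[X]) (hg : gp.natDegree ≤ P) :
    ∫ x in (-1 : ℝ)..1, gp.eval x * (G.eval x * F.eval x)
      = xFin N P gp (legCoeff F) (legCoeff G)
        + ∫ x in (-1 : ℝ)..1, gp.eval x * ((tailFrom (N + 2) G).eval x * (tailFrom (N + 1) F).eval x) := by
  set D := max F.natDegree G.natDegree + 1 with hD
  set R := N + P + 3 + D with hR
  have hF : F.natDegree < R := by omega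
  have hG : G.natDegree < R := by omega
  have hFt : (tailFrom (N + 1) F).natDegree < R := lt_of_le_of_lt (natDegree_tailFrom_le _ F) (by omega)
  have hGt : (tailFrom (N + 2) G).natDegree < R := lt_of_le_of_lt (natDegree_tailFrom_le _ G) (by omega)
  rw [integral_g_mul_mul gp F G hF hG, integral_g_mul_mul gp _ _ hFt hGt]
  simp_rw [legCoeff_tailFrom]
  -- Φ = the `S`-summand, Ψ = (all pairs) − (tail pairs)
  set f := legCoeff F with hf
  set e := legCoeff G with he
  have key : ∀ n m, f n * e m * lam3 gp n m
      = (if inS N P n m then lam3 gp n m else 0) * f n * e m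
        + (if n < N + 1 then 0 else f n) * (if m < N + 2 then 0 else e m) * lam3 gp n m := by
    intro n m
    by_cases hS : inS N P n m
    · rw [if_pos hS]
      have hhead : n < N + 1 ∨ m < N + 2 := by unfold inS at hS; omega
      rcases hhead with hn | hm
      · rw [if_pos hn]; ring
      · rw [if_pos hm]; ring
    · rw [if_neg hS]
      by_cases hn : n < N + 1
      · -- head of F: then Λ = 0 unless m ≤ N + P, which would put (n, m) in S
        rw [if_pos hn]
        by_cases hm2 : m < N + 2
        · exfalso; apply hS; unfold inS; omega
        · have hfar : n + P < m := by unfold inS at hS; omega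
          rw [lam3_eq_zero_of_far hg hfar]; ring
      · rw [if_neg hn]
        by_cases hm : m < N + 2
        · -- head of G: then Λ = 0 unless n ≤ N + P + 1, which would put (n, m) in S
          rw [if_pos hm]
          have hfar : m + P < n := by unfold inS at hS; omega
          rw [lam3_eq_zero_of_far' hg hfar]; ring
        · rw [if_neg hm]; ring
  rw [sum_congr rfl fun n _ => sum_congr rfl fun m _ => key n m]
  simp_rw [sum_add_distrib]
  congr 1
  -- window reduction for the `S`-sum
  unfold xFin
  refine sum_sum_window (by omega) (by omega) (fun n m hn => ?_) (fun n m hm => ?_)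
  · rw [if_neg (by unfold inS; omega)]; ring
  · rw [if_neg (by unfold inS; omega)]; ring

/-! ## 5. The fw16 cross term of a pair and the Young bound on its tail -/

/-- **The cross term of the pair `(U, V)` split** (`W = U + iV`, `Im(W′W̄) = V′U − U′V`): exact tracked part (antisymmetric in the roles)
plus the tail cross term `X_t = ∫ g·(ṽ₁ũ₀ − ũ₁ṽ₀)`. -/
theorem coupling_split_pair (N P : ℕ) (gp Up Vp : ℝ[X]) (hg : gp.natDegree ≤ P) :
    ∫ x in (-1 : ℝ)..1, gp.eval x * ((derivative Vp).eval x * Up.eval x - (derivative Up).eval x * Vp.eval x)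
      = (xFin N P gp (legCoeff Up) (legCoeff (derivative Vp)) - xFin N P gp (legCoeff Vp) (legCoeff (derivative Up)))
        + ∫ x in (-1 : ℝ)..1, gp.eval x * ((tailFrom (N + 2) (derivative Vp)).eval x * (tailFrom (N + 1) Up).eval x
            - (tailFrom (N + 2) (derivative Up)).eval x * (tailFrom (N + 1) Vp).eval x) := by
  have i₁ : IntervalIntegrable (fun x => gp.eval x * ((derivative Vp).eval x * Up.eval x)) volume (-1 : ℝ) 1 :=
    Continuous.intervalIntegrable (by fun_prop) _ _
  have i₂ : IntervalIntegrable (fun x => gp.eval x * ((derivative Up).eval x * Vp.eval x)) volume (-1 : ℝ) 1 :=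
    Continuous.intervalIntegrable (by fun_prop) _ _
  have j₁ : IntervalIntegrable (fun x => gp.eval x * ((tailFrom (N + 2) (derivative Vp)).eval x * (tailFrom (N + 1) Up).eval x))
      volume (-1 : ℝ) 1 := Continuous.intervalIntegrable (by fun_prop) _ _
  have j₂ : IntervalIntegrable (fun x => gp.eval x * ((tailFrom (N + 2) (derivative Up)).eval x * (tailFrom (N + 1) Vp).eval x))
      volume (-1 : ℝ) 1 := Continuous.intervalIntegrable (by fun_prop) _ _
  have e1 : (∫ x in (-1 : ℝ)..1, gp.eval x * ((derivative Vp).eval x * Up.eval x - (derivative Up).eval x * Vp.eval x))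
      = (∫ x in (-1 : ℝ)..1, gp.eval x * ((derivative Vp).eval x * Up.eval x))
        - ∫ x in (-1 : ℝ)..1, gp.eval x * ((derivative Up).eval x * Vp.eval x) := by
    rw [← intervalIntegral.integral_sub i₁ i₂]
    exact intervalIntegral.integral_congr fun x _ => by ring
  have e2 : (∫ x in (-1 : ℝ)..1, gp.eval x * ((tailFrom (N + 2) (derivative Vp)).eval x * (tailFrom (N + 1) Up).eval x
        - (tailFrom (N + 2) (derivative Up)).eval x * (tailFrom (N + 1) Vp).eval x))
      = (∫ x in (-1 : ℝ)..1, gp.eval x * ((tailFrom (N + 2) (derivative Vp)).eval x * (tailFrom (N + 1) Up).eval x))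
        - ∫ x in (-1 : ℝ)..1, gp.eval x * ((tailFrom (N + 2) (derivative Up)).eval x * (tailFrom (N + 1) Vp).eval x) := by
    rw [← intervalIntegral.integral_sub j₁ j₂]
    exact intervalIntegral.integral_congr fun x _ => by ring
  rw [e1, e2, coupling_split N P gp Up (derivative Vp) hg, coupling_split N P gp Vp (derivative Up) hg]
  ring

/-- Young's inequality in the form used by rbsdp SPEC 2.7: `|a|·|b| ≤ (δ/2)a² + b²/(2δ)` for `δ > 0`. -/
theorem abs_mul_abs_le_young {δ : ℝ} (hδ : 0 < δ) (a b : ℝ) : |a| * |b| ≤ δ / 2 * a ^ 2 + b ^ 2 / (2 * δ) := by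
  have h2δ : 0 < 2 * δ := by positivity
  have e : δ / 2 * a ^ 2 + b ^ 2 / (2 * δ) = (δ ^ 2 * a ^ 2 + b ^ 2) / (2 * δ) := by
    field_simp
  rw [e, le_div_iff₀ h2δ]
  nlinarith [sq_nonneg (δ * |a| - |b|), sq_abs a, sq_abs b, abs_nonneg a, abs_nonneg b]

/-- One tail product: `|∫ g·A·B| ≤ T·((δ/2)∫B² + ∫A²/(2δ))` when `|g| ≤ T` on `[−1, 1]` (continuous data). -/
theorem abs_integral_g_mul_mul_le {g A B : ℝ → ℝ} (hg : Continuous g) (hA : Continuous A) (hB : Continuous B) {T δ : ℝ}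
    (hT : ∀ x ∈ Icc (-1 : ℝ) 1, |g x| ≤ T) (hδ : 0 < δ) :
    |∫ x in (-1 : ℝ)..1, g x * (A x * B x)|
      ≤ T * (δ / 2 * (∫ x in (-1 : ℝ)..1, B x ^ 2) + (∫ x in (-1 : ℝ)..1, A x ^ 2) / (2 * δ)) := by
  have hT0 : 0 ≤ T := le_trans (abs_nonneg _) (hT (-1) ⟨le_rfl, by norm_num⟩)
  have hpt : ∀ x ∈ Icc (-1 : ℝ) 1, |g x * (A x * B x)| ≤ T * (δ / 2 * B x ^ 2 + A x ^ 2 / (2 * δ)) := by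
    intro x hx
    rw [abs_mul, abs_mul]
    have hy := abs_mul_abs_le_young hδ (B x) (A x)
    calc |g x| * (|A x| * |B x|) ≤ T * (|B x| * |A x|) := by
          rw [mul_comm |A x|]; exact mul_le_mul_of_nonneg_right (hT x hx) (by positivity)
      _ ≤ T * (δ / 2 * B x ^ 2 + A x ^ 2 / (2 * δ)) := mul_le_mul_of_nonneg_left hy hT0
  have i0 : IntervalIntegrable (fun x => g x * (A x * B x)) volume (-1 : ℝ) 1 := Continuous.intervalIntegrable (by fun_prop) _ _
  have iB : IntervalIntegrable (fun x => δ / 2 * B x ^ 2) volume (-1 : ℝ) 1 := Continuous.intervalIntegrable (by fun_prop) _ _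
  have iA : IntervalIntegrable (fun x => A x ^ 2 / (2 * δ)) volume (-1 : ℝ) 1 := Continuous.intervalIntegrable (by fun_prop) _ _
  calc |∫ x in (-1 : ℝ)..1, g x * (A x * B x)|
      ≤ ∫ x in (-1 : ℝ)..1, |g x * (A x * B x)| := intervalIntegral.abs_integral_le_integral_abs (by norm_num)
    _ ≤ ∫ x in (-1 : ℝ)..1, T * (δ / 2 * B x ^ 2 + A x ^ 2 / (2 * δ)) :=
        intervalIntegral.integral_mono_on (by norm_num) i0.abs ((iB.add iA).const_mul T) hpt
    _ = T * (δ / 2 * (∫ x in (-1 : ℝ)..1, B x ^ 2) + (∫ x in (-1 : ℝ)..1, A x ^ 2) / (2 * δ)) := by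
        rw [intervalIntegral.integral_const_mul, intervalIntegral.integral_add iB iA, intervalIntegral.integral_const_mul,
          intervalIntegral.integral_div]

/-- **Young bound on the tail cross term** (rbsdp SPEC 2.7): with `|g| ≤ T` on `[−1, 1]` and `δ > 0`,
`|∫ g·(ṽ₁ũ₀ − ũ₁ṽ₀)| ≤ T·((δ/2)(‖ũ₀‖² + ‖ṽ₀‖²) + (‖ũ₁‖² + ‖ṽ₁‖²)/(2δ))` for continuous `ũ₀, ũ₁, ṽ₀, ṽ₁`. -/
theorem coupling_tail_young {g u0 u1 v0 v1 : ℝ → ℝ} (hg : Continuous g) (hu0 : Continuous u0) (hu1 : Continuous u1)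
    (hv0 : Continuous v0) (hv1 : Continuous v1) {T δ : ℝ} (hT : ∀ x ∈ Icc (-1 : ℝ) 1, |g x| ≤ T) (hδ : 0 < δ) :
    |∫ x in (-1 : ℝ)..1, g x * (v1 x * u0 x - u1 x * v0 x)|
      ≤ T * (δ / 2 * ((∫ x in (-1 : ℝ)..1, u0 x ^ 2) + ∫ x in (-1 : ℝ)..1, v0 x ^ 2)
          + ((∫ x in (-1 : ℝ)..1, u1 x ^ 2) + ∫ x in (-1 : ℝ)..1, v1 x ^ 2) / (2 * δ)) := by
  have i₁ : IntervalIntegrable (fun x => g x * (v1 x * u0 x)) volume (-1 : ℝ) 1 := Continuous.intervalIntegrable (by fun_prop) _ _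
  have i₂ : IntervalIntegrable (fun x => g x * (u1 x * v0 x)) volume (-1 : ℝ) 1 := Continuous.intervalIntegrable (by fun_prop) _ _
  have e : (∫ x in (-1 : ℝ)..1, g x * (v1 x * u0 x - u1 x * v0 x))
      = (∫ x in (-1 : ℝ)..1, g x * (v1 x * u0 x)) - ∫ x in (-1 : ℝ)..1, g x * (u1 x * v0 x) := by
    rw [← intervalIntegral.integral_sub i₁ i₂]
    exact intervalIntegral.integral_congr fun x _ => by ring
  rw [e]
  have h1 := abs_integral_g_mul_mul_le hg hv1 hu0 hT hδ
  have h2 := abs_integral_g_mul_mul_le hg hu1 hv0 hT hδ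
  calc |(∫ x in (-1 : ℝ)..1, g x * (v1 x * u0 x)) - ∫ x in (-1 : ℝ)..1, g x * (u1 x * v0 x)|
      ≤ |∫ x in (-1 : ℝ)..1, g x * (v1 x * u0 x)| + |∫ x in (-1 : ℝ)..1, g x * (u1 x * v0 x)| := abs_sub _ _
    _ ≤ T * (δ / 2 * (∫ x in (-1 : ℝ)..1, u0 x ^ 2) + (∫ x in (-1 : ℝ)..1, v1 x ^ 2) / (2 * δ))
        + T * (δ / 2 * (∫ x in (-1 : ℝ)..1, v0 x ^ 2) + (∫ x in (-1 : ℝ)..1, u1 x ^ 2) / (2 * δ)) := add_le_add h1 h2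
    _ = _ := by ring

end Summit.NavierStokesRegularity.TurbBounds.ShearCoupling

end
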